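import Summits.ResolutionOfSingularities.ResolutionOfSingularities.Theorems.MarkedTransferCampaignW46MohWindowSurfaceFreeze
import Summits.ResolutionOfSingularities.ResolutionOfSingularities.Theorems.MarkedTransferCampaignW46MohWindowSurfaceFormTransfer
import Mathlib.RingTheory.Polynomial.Content
import HarnessLib

/-!
# [OURS · L1 W4.6 rung (iii-2), HEAVY-ROOT SIDE, `p = 2`] Surface Moh window — an admitted centre at `p = 2` is a CUBE point:
# every prime factor of its residue cubic has multiplicity `0` or `3` (cell res-hironaka, LADDER-RESOLUTION rung L, D-0089; seat
# res-L1-s46-pv-5 gen 4; host MarkedTransfer, `--supports stmt-ResolutionOfSingularities-16155 --as helper`)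

HONEST FRAMING. Nothing here is a statement of H. Hironaka's manuscript [Hironaka2017] and nothing here asserts that any
statement of it holds. Polynomial algebra over a field plus the top-of-window rigidity `…Freeze.lean`; step (1′) of
res-L1-s46-pv-5's «p = 2 programme». AI-written; AI review is weaker than expert review. No `sorry`; axioms standard.

THE POINT. `cube_factor_of_no_simple_factor` (pure algebra): a cubic `F = Σ_{k ≤ 3} ā_k X^k ≠ 0` over a field such that neither
`F` nor its reversal `Σ ā_{3−k} X^k` has a prime factor of multiplicity one, has at EVERY prime `π` a factorisation `F = π^μ · G₀`,
`π ∤ G₀`, with `μ ∈ {0, 3}` (a double factor forces a simple cofactor, or — for `c(αX + β)²` — the simple factor `X` of the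
reversal). `cube_factor_of_transform_mem` (scheme level, `p = 2`): if a §2.1-permissible blow-up of a state of
`Regime.mohWindowSurface` has its transform again in the regime, then the regime-type coefficient presentation at the centre point
has this cube factorisation property, in the `x`-chart reading AND in the `y`-chart reading (`…Freeze.lean` applied to the
presentation and to its swap `coeffForm_swap`) — the input format of res-D-pv-050's `exists_core_data_of_factor` with multiplicity
predicate `μ = 0 ∨ μ = 3`. [Matsumura1987] [HauserWagner2014]
-/

noncomputable section

set_option linter.dupNamespace false -- mandated namespace of this single-conjunct summit

open CategoryTheory AlgebraicGeometry TopologicalSpace IsLocalRing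

namespace Summit.ResolutionOfSingularities.ResolutionOfSingularities.Theorems

namespace CampaignW46

open Literature.AlgebraicGeometry.Resolution
open Literature.AlgebraicGeometry.Hironaka2017.S02Preliminaries
open Literature.AlgebraicGeometry.Hironaka2017.Datum
open Literature.AlgebraicGeometry.Hironaka2017.S16Proof
open Scheme.IdealSheafData
open Polynomial

universe u

namespace MohWindowSurface

/-! ## 1. Polynomial algebra: no simple factor in a cubic and in its reversal -/

variable {κ : Type*} [Field κ]

/-- Coefficients of the cubic `Σ_{k ≤ 3} C(a k) X^k`. [folklore] -/
theorem coeff_cubicSum (a : ℕ → κ) (n : ℕ) (hn : n ≤ 3) :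
    (∑ k ∈ Finset.range (3 + 1), C (a k) * X ^ k).coeff n = a n := by
  rw [finsetSum_coeff]
  simp only [coeff_C_mul_X_pow]
  rw [Finset.sum_eq_single n]
  · rw [if_pos rfl]
  · intro k _ hk; rw [if_neg (Ne.symm hk)]
  · intro h; exact absurd (Finset.mem_range.mpr (by omega)) h

/-- The cubic `Σ_{k ≤ 3} C(a k) X^k` has degree `≤ 3`. [folklore] -/
theorem natDegree_cubicSum_le (a : ℕ → κ) : (∑ k ∈ Finset.range (3 + 1), C (a k) * X ^ k).natDegree ≤ 3 :=
  natDegree_sum_le_of_forall_le _ _ fun k hk =>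
    (natDegree_C_mul_X_pow_le (a k) k).trans (Nat.lt_succ_iff.mp (Finset.mem_range.mp hk))

/-- **[OURS · L1 W4.6 rung (iii-2), `p = 2`] A CUBIC WITH NO SIMPLE FACTOR IN EITHER READING IS A CUBE AT EVERY PRIME.**
`F = Σ_{k ≤ 3} ā_k X^k ≠ 0` over a field; if NO prime divides `F` exactly once and NO prime divides the reversal `Σ ā_{3−k} X^k`
exactly once, then every prime `π` has `F = π^μ G₀`, `π ∤ G₀` with `μ = 0 ∨ μ = 3`. NOT a statement of the manuscript. [folklore] -/
theorem cube_factor_of_no_simple_factor (a : ℕ → κ) (hne : (∑ k ∈ Finset.range (3 + 1), C (a k) * X ^ k) ≠ 0)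
    (h0 : ∀ π G : κ[X], Prime π → (∑ k ∈ Finset.range (3 + 1), C (a k) * X ^ k) = π * G → π ∣ G)
    (h1 : ∀ π G : κ[X], Prime π → (∑ k ∈ Finset.range (3 + 1), C (a (3 - k)) * X ^ k) = π * G → π ∣ G)
    (π : κ[X]) (hπ : Prime π) :
    ∃ (μ : ℕ) (G₀ : κ[X]), (μ = 0 ∨ μ = 3) ∧ (∑ k ∈ Finset.range (3 + 1), C (a k) * X ^ k) = π ^ μ * G₀ ∧ ¬ π ∣ G₀ := by
  classical
  set F := ∑ k ∈ Finset.range (3 + 1), C (a k) * X ^ k with hFdef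
  obtain ⟨μ, G₀, hndvd, hFeq⟩ := WfDvdMonoid.max_power_factor' hne hπ.not_unit
  refine ⟨μ, G₀, ?_, hFeq, hndvd⟩
  have hG₀0 : G₀ ≠ 0 := by rintro rfl; exact hne (by rw [hFeq, mul_zero])
  have hπ0 : π ≠ 0 := hπ.ne_zero
  have hπdeg : 1 ≤ π.natDegree :=
    natDegree_pos_iff_degree_pos.mpr (degree_pos_of_irreducible hπ.irreducible)
  -- degree bookkeeping: `μ · deg π + deg G₀ = deg F ≤ 3`
  have hdeg : μ * π.natDegree + G₀.natDegree ≤ 3 := by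
    have := natDegree_cubicSum_le a
    rw [← hFdef, hFeq, natDegree_mul (pow_ne_zero _ hπ0) hG₀0, natDegree_pow] at this
    exact this
  -- exclude `μ = 1`, `μ = 2`, `μ ≥ 4`
  have hμ4 : μ ≤ 3 := by nlinarith
  interval_cases μ
  · exact Or.inl rfl
  · exact absurd (h0 π G₀ hπ (by rw [hFeq, pow_one])) hndvd
  · exfalso
    have hπ1 : π.natDegree = 1 := by omega
    have hG₀deg : G₀.natDegree ≤ 1 := by omega
    by_cases hG1 : G₀.natDegree = 1
    · -- `G₀` is a simple factor of `F = G₀ · π²`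
      have hG₀prime : Prime G₀ := (irreducible_of_degree_eq_one (by
        rw [degree_eq_natDegree hG₀0, hG1]; rfl)).prime
      have hdvd : G₀ ∣ π ^ 2 := h0 G₀ (π ^ 2) hG₀prime (by rw [hFeq, mul_comm])
      have hGπ : G₀ ∣ π := hG₀prime.dvd_of_dvd_pow hdvd
      -- two primes of degree one dividing each other are associated
      obtain ⟨e, he⟩ := hGπ
      have heu : IsUnit e := by
        rcases hπ.irreducible.isUnit_or_isUnit he with h | h
        · exact absurd h hG₀prime.not_unit
        · exact h
      apply hndvd
      obtain ⟨e', he'⟩ := heu.exists_right_inv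
      exact ⟨e', by rw [he, mul_assoc, he', mul_one]⟩
    · -- `G₀ = C g`, `π = C α X + C β`: the reversal has the simple factor `X`
      have hG0 : G₀.natDegree = 0 := by omega
      obtain ⟨g, hg⟩ : ∃ g, G₀ = C g := ⟨_, eq_C_of_natDegree_eq_zero hG0⟩
      have hg0 : g ≠ 0 := by rintro rfl; exact hG₀0 (by rw [hg, map_zero])
      obtain ⟨α, hα, β, hπeq⟩ := natDegree_eq_one.mp hπ1
      -- coefficients of `F = C g (C α X + C β)²`
      have hFexp : F = C (g * β ^ 2) * X ^ 0 + C (2 * g * α * β) * X ^ 1 + C (g * α ^ 2) * X ^ 2 := by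
        rw [hFeq, hg, ← hπeq]; simp only [map_mul, map_pow, map_ofNat]; ring
      have hc : ∀ n ≤ 3, a n =
          (C (g * β ^ 2) * X ^ 0 + C (2 * g * α * β) * X ^ 1 + C (g * α ^ 2) * X ^ 2 : κ[X]).coeff n := by
        intro n hn; rw [← coeff_cubicSum a n hn, ← hFdef, hFexp]
      have ha0 : a 0 = g * β ^ 2 := by
        rw [hc 0 (by norm_num)]; simp only [coeff_add, coeff_C_mul_X_pow]; norm_num
      have ha1 : a 1 = 2 * g * α * β := by
        rw [hc 1 (by norm_num)]; simp only [coeff_add, coeff_C_mul_X_pow]; norm_num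
      have ha2 : a 2 = g * α ^ 2 := by
        rw [hc 2 (by norm_num)]; simp only [coeff_add, coeff_C_mul_X_pow]; norm_num
      have ha3 : a 3 = 0 := by
        rw [hc 3 (by norm_num)]; simp only [coeff_add, coeff_C_mul_X_pow]; norm_num
      -- the reversal is `X · (C g (C α + C β X)²)`
      have hrev : (∑ k ∈ Finset.range (3 + 1), C (a (3 - k)) * X ^ k) = X * (C g * (C α + C β * X) ^ 2) := by
        simp only [Finset.sum_range_succ, Finset.sum_range_zero, zero_add, pow_zero, mul_one, pow_one, Nat.sub_zero,
          Nat.sub_self, Nat.reduceSub, ha0, ha1, ha2, ha3]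
        simp only [map_mul, map_pow, map_ofNat, map_zero]
        ring
      have hX := h1 X _ prime_X hrev
      rw [X_dvd_iff, coeff_zero_eq_eval_zero] at hX
      simp only [eval_mul, eval_pow, eval_add, eval_C, eval_X, mul_zero, add_zero] at hX
      rcases mul_eq_zero.mp hX with h | h
      · exact hg0 h
      · exact hα (pow_eq_zero_iff two_ne_zero |>.mp h)
  · exact Or.inr rfl

end MohWindowSurface

/-! ## 2. Scheme level: an admitted centre inside the regime is a cube point -/

section Campaign

variable {K : Type u} [Field K] [CharP K 2]
variable {A A' : AmbientDatum 2 K} {E : IdealExponent A.Z}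

/-- **[OURS · L1 W4.6 rung (iii-2), `p = 2`] AN ADMITTED CENTRE INSIDE THE REGIME IS A CUBE POINT.** Let `π : Z′ → Z` be a
§2.1-permissible blow-up of a state `(A, E)` of `Regime.mohWindowSurface` (`p = 2`) whose transform is AGAIN in the regime, and let
`J_y = (z² + Σ_{k ≤ 3} a_k x^{3−k} y^k)` be any coefficient window presentation at the centre point `y` (a unit among the `a_k`).
Then the residue cubic `Σ ā_k X^k` and its reversal `Σ ā_{3−k} X^k` both factor at EVERY prime `π₀` as `π₀^μ · G₀`, `π₀ ∤ G₀`,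
`μ ∈ {0, 3}` — the input of res-D-pv-050's `exists_core_data_of_factor` in both charts. By `…Freeze.lean` (a simple factor would
make the transform leave the regime) and `cube_factor_of_no_simple_factor`. NOT a statement of the manuscript. [folklore] -/
theorem cube_factor_of_transform_mem {D : Closeds A.Z} (π : A'.Z ⟶ A.Z) (hπ : IsBlowup π (vanishingIdeal D))
    (hD : E.IsPermissibleCentre A.hom D) (hRg : Regime.mohWindowSurface A E)
    (hRg' : Regime.mohWindowSurface A' (E.transform π D)) {y : A.Z} (hyD : y ∈ (D : Set A.Z))
    {x₁ y₁ z₁ : A.Z.presheaf.stalk y} (hxyz : Ideal.span {x₁, y₁, z₁} = maximalIdeal _) (a : ℕ → A.Z.presheaf.stalk y)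
    (hunit : ∃ j ≤ 3, IsUnit (a j))
    (hJ : stalkIdeal E.J y = Ideal.span {z₁ ^ 2 + ∑ k ∈ Finset.range (3 + 1), a k * x₁ ^ (3 - k) * y₁ ^ k}) :
    (∀ π₀ : (ResidueField (A.Z.presheaf.stalk y))[X], Prime π₀ → ∃ (μ : ℕ) (G₀ : (ResidueField (A.Z.presheaf.stalk y))[X]),
      (μ = 0 ∨ μ = 3) ∧ (∑ k ∈ Finset.range (3 + 1), C (residue _ (a k)) * X ^ k) = π₀ ^ μ * G₀ ∧ ¬ π₀ ∣ G₀) ∧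
    (∀ π₀ : (ResidueField (A.Z.presheaf.stalk y))[X], Prime π₀ → ∃ (μ : ℕ) (G₀ : (ResidueField (A.Z.presheaf.stalk y))[X]),
      (μ = 0 ∨ μ = 3) ∧ (∑ k ∈ Finset.range (3 + 1), C (residue _ (a (3 - k))) * X ^ k) = π₀ ^ μ * G₀ ∧ ¬ π₀ ∣ G₀) := by
  classical
  -- no simple factor in either reading, by the top-of-window rigidity
  have h0 : ∀ π₀ G₀ : (ResidueField (A.Z.presheaf.stalk y))[X], Prime π₀ →
      (∑ k ∈ Finset.range (3 + 1), C (residue _ (a k)) * X ^ k) = π₀ * G₀ → π₀ ∣ G₀ := by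
    intro π₀ G₀ hπ₀ hF
    by_contra hG₀
    exact not_mohWindowSurface_transform_of_simple_root π hπ hD hRg hyD hxyz (by norm_num) a hJ hπ₀ hF hG₀ hRg'
  have hyxz : Ideal.span {y₁, x₁, z₁} = maximalIdeal _ := by rw [← hxyz, Set.insert_comm]
  have hJ' : stalkIdeal E.J y = Ideal.span {z₁ ^ 2 + ∑ k ∈ Finset.range (3 + 1), a (3 - k) * y₁ ^ (3 - k) * x₁ ^ k} := by
    rw [hJ, MohWindowSurface.coeffForm_swap]
  have h1 : ∀ π₀ G₀ : (ResidueField (A.Z.presheaf.stalk y))[X], Prime π₀ →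
      (∑ k ∈ Finset.range (3 + 1), C (residue _ (a (3 - k))) * X ^ k) = π₀ * G₀ → π₀ ∣ G₀ := by
    intro π₀ G₀ hπ₀ hF
    by_contra hG₀
    exact not_mohWindowSurface_transform_of_simple_root π hπ hD hRg hyD hyxz (by norm_num) (fun k => a (3 - k)) hJ' hπ₀
      hF hG₀ hRg'
  -- the cubic is non-zero: a unit coefficient
  have hne : (∑ k ∈ Finset.range (3 + 1), C (residue _ (a k)) * X ^ k) ≠ 0 := by
    obtain ⟨j, hj, hju⟩ := hunit
    intro h
    have := MohWindowSurface.coeff_cubicSum (fun k => residue _ (a k)) j hj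
    rw [h, coeff_zero] at this
    exact ((mem_maximalIdeal _).mp ((residue_eq_zero_iff _).mp this.symm)) hju
  have hne' : (∑ k ∈ Finset.range (3 + 1), C (residue _ (a (3 - k))) * X ^ k) ≠ 0 := by
    obtain ⟨j, hj, hju⟩ := hunit
    intro h
    have := MohWindowSurface.coeff_cubicSum (fun k => residue _ (a (3 - k))) (3 - j) (by omega)
    rw [h, coeff_zero, Nat.sub_sub_self hj] at this
    exact ((mem_maximalIdeal _).mp ((residue_eq_zero_iff _).mp this.symm)) hju
  refine ⟨fun π₀ hπ₀ => MohWindowSurface.cube_factor_of_no_simple_factor (fun k => residue _ (a k)) hne h0 h1 π₀ hπ₀,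
    fun π₀ hπ₀ => MohWindowSurface.cube_factor_of_no_simple_factor (fun k => residue _ (a (3 - k))) hne' h1 ?_ π₀ hπ₀⟩
  intro π₁ G₁ hπ₁ hF₁
  have hrr : (∑ k ∈ Finset.range (3 + 1), C (residue _ (a (3 - (3 - k)))) * X ^ k) =
      ∑ k ∈ Finset.range (3 + 1), C (residue (A.Z.presheaf.stalk y) (a k)) * X ^ k :=
    Finset.sum_congr rfl fun k hk => by rw [Nat.sub_sub_self (Nat.lt_succ_iff.mp (Finset.mem_range.mp hk))]
  rw [hrr] at hF₁
  exact h0 π₁ G₁ hπ₁ hF₁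

end Campaign

end CampaignW46

end Summit.ResolutionOfSingularities.ResolutionOfSingularities.Theorems

end
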